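import Summits.BirchSwinnertonDyer.Rank1Residual.Additive.LocalZpExtension
import Literature.NumberTheory.EllipticCurves.IwasawaSelmerControlAwayFromPProofs
import Literature.NumberTheory.EllipticCurves.IwasawaSelmerControlKernelCardProofs
import HarnessLib

/-!
# `𝒦_{v,0}[p^∞] ≅ (M_∞/(g−1)M_∞)[p^∞]` EXACTLY: inflation cocycles for `p`-power-torsion values
# via the local `ℤ_p`-extension (cell `b2b-bsdres`, CLASS-CLOSURE lane, class O10 — x1b GEN 35,
# class lead; file 52 of the series: brick B4 of the GLOBAL count (C), part 3 — the surjectivity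
# half of Greenberg's `ker(r_v) ≅ H¹(Γ_v, ·)` at the `p`-primary level)

HONEST FRAMING (cell `b2b-bsdres`, run/shared/lean/b2b/bsd-rank1-residual/, verbatim in every
file): the goal of the cell is to DELETE the COMBINATION-SHAPED residual classes of the
Birch–Swinnerton-Dyer formula for ALL analytic-rank `≤ 1` elliptic curves over `ℚ` — "full BSD
formula for every rank `≤ 1` curve in class `C`" assembled STRICTLY from published theorems — so
that the rank-`≤ 1` remainder becomes exactly the CONSTRUCTION-SHAPED classes, which are TYPED
(missing-input `Prop`s), NOT attempted. This is not "finishing BSD". CLASS-CLOSURE lane: prove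
what is provable now; shrink each hard class to its core with data; no claim beyond stated classes;
research routes on CONSTRUCTION-SHAPED X12 / O10; census / instrument output = EVIDENCE / conjecture
items, NEVER a Literature fact; `RESIDUAL-MAP.md` marks change only by signed lines. THIS FILE:
TOOL THEOREMS ONLY over the tree's `ResKernel` / `PrimaryCoinvariants` / `ZpExtension` /
`localTowerKer` vocabulary — no definition, no named Literature fact, no Summits-side fact
`def … : Prop`, no `sorry`, axioms standard; nothing is booked; no label / mark / count / sub-cell
moves; O10 stays OPEN / CONSTRUCTION-SHAPED; nothing about `BSD(W, p)` of any pair is claimed.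

## What (brick B4 of `B2-LOCALISATION-x1b.md` §3, step (ii))

The tree's Lemma 3.3 mechanism (`ResKernel.finite_primary_subgroupResKer_and_card_le`,
`WeierstrassCurve.finite_localTowerKerPrimary_and_card_le`) EMBEDS the `p`-power torsion of
`ker(res : H¹(G, M) → H¹(N, M))` into `(M^N/(γ−1)M^N)[p^∞]` (evaluation at `γ`). Here:

* §1 (generic) `natCard_primary_subgroupResKer_eq`: the embedding is a BIJECTION as soon as (hinf)
  every `p`-power-torsion `b ∈ M^N` is the value at `γ` of a continuous cocycle on `G` vanishing on
  `N`, and (hdiv) `M^N/B` is `p`-divisible (`B = M^N[p^∞]`): then every class of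
  `(M^N/(γ−1)M^N)[p^∞]` is represented by some `b ∈ B` (the tree's `PrimaryCoinvariants` argument)
  and hence hit. So `#{x ∈ ker res | p-power torsion} = #(M^N/(γ−1)M^N)[p^∞]`.
* §2 (local) `exists_generator_and_cocycles`: for a `ℤ_p`-extension `κ` of `K`, a `K`-field `E` of
  characteristic `0` that does NOT split completely (`res(Γ_E) ⊄ ker κ`), and a curve `W/K`: there is
  `g ∈ Γ_E` generating `Γ_E` topologically together with `H_{E,∞} = Gal(K̄_E/K_∞·E)` such that
  (hinf) holds for `M = E(K̄_E)`, `N = H_{E,∞}` inside `H_{E,0} = Γ_E` — by file 51's local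
  `ℤ_p`-extension `κ_E` (`ker κ_E = H_{E,∞}`, `κ_E g = 1`) and the tree's inflation cocycles
  `ZpExtension.exists_cocycle_vanishing_apply_eq` on the `p`-primary `Γ_E`-module `E(K̄_E)[p^∞]`.
* §2 **`natCard_localTowerKerPrimary_zero_eq`**: with that `g`,
  **`#𝒦_{E,0}[p^∞] = #(E(K_∞·E)/(g−1)E(K_∞·E))[p^∞]`** whenever (hdiv) `E(K_∞·E)/E(K_∞·E)[p^∞]` is
  `p`-divisible and the right side is finite — the EQUALITY form of the tree's
  `finite_localTowerKerPrimary_and_card_le` at `n = 0`. At `v ∤ p`, (hdiv) and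
  `#(…)[p^∞] = #B/(g−1)B = p^{ord_p c_v}` are n1011's (a) and X11b's count read through file 50; the
  assembly `#𝒦_{v,0}[p^∞] = p^{ord_p c_v}` (B4) is then bookkeeping over n1011's bridge.

References: [GreenbergLNM1716] R. Greenberg, LNM 1716 (1999), §3 Lemmas 3.1, 3.3 (pp. 86–88), §4
p. 74 ("`ker r_v` has order `c_v^{(p)}`"); [SerreGaloisCohomology1997] I.§2.6, XIII.§1.
-/

noncomputable section

open scoped Classical

universe u

namespace Summit.BirchSwinnertonDyer.Rank1Residual.Additive

open Literature.NumberTheory.EllipticCurves Literature.NumberTheory.GaloisRepresentations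
  Literature.NumberTheory.EllipticCurves.ResKernel Literature.NumberTheory.EllipticCurves.PrimaryCoinvariants
  ZpExtension

/-! ## §1 Generic: the `p`-primary evaluation embedding is onto -/

section Generic

variable {G : Type u} [Group G] [TopologicalSpace G] [IsTopologicalGroup G]
  (N : Subgroup G) [N.Normal] (M : Type u) [AddCommGroup M] [DistribMulAction G M]
  [TopologicalSpace M] [DiscreteTopology M]

/-- **`#{x ∈ ker(res : H¹(G,M) → H¹(N,M)) : p-power torsion} = #(M^N/(γ−1)M^N)[p^∞]`** when `N` and
`γ` generate `G` topologically, (hinf) every `p`-power-torsion `b ∈ M^N` is `ψ(γ)` for a continuous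
cocycle `ψ` on `G` vanishing on `N`, and (hdiv) `M^N` is `p`-divisible modulo `M^N[p^∞]`: the
tree's injective evaluation map (`exists_addMonoidHom_subgroupResKer_injective`) is then onto the
`p`-primary classes, each of which is represented by a `p`-power-torsion element (Greenberg's
"the uniquely divisible part contributes nothing"). [cite: GreenbergLNM1716, §3 Lemmas 3.1 and 3.3 (pp. 86–87)] -/
theorem natCard_primary_subgroupResKer_eq (γ : G)
    (hgen : ∀ U : Subgroup G, IsOpen (U : Set G) → N ≤ U → γ ∈ U → U = ⊤)
    (hcont : ∀ m : M, Continuous fun g : G ↦ g • m) (p : ℕ)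
    (hinf : ∀ b : FixedPoints.addSubgroup N M, (∃ k : ℕ, p ^ k • b = 0) →
      ∃ ψ : contOneCocycles (discreteTopRep G M), (∀ n ∈ N, ψ.1 n = 0) ∧ ψ.1 γ = b)
    (hdiv : ∀ y : FixedPoints.addSubgroup N M, ∃ y' : FixedPoints.addSubgroup N M,
      y - p • y' ∈ AddCommGroup.primaryComponent (FixedPoints.addSubgroup N M) p)
    [Finite (AddCommGroup.primaryComponent
      (FixedPoints.addSubgroup N M ⧸ (subOne N M γ).range) p)] :
    Nat.card {x : subgroupResKer M N // ∃ k : ℕ, p ^ k • x = 0} =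
      Nat.card (AddCommGroup.primaryComponent
        (FixedPoints.addSubgroup N M ⧸ (subOne N M γ).range) p) := by
  obtain ⟨w, hw, hwval⟩ := exists_addMonoidHom_subgroupResKer_injective N M γ hgen hcont
  let f : {x : subgroupResKer M N // ∃ k : ℕ, p ^ k • x = 0} →
      AddCommGroup.primaryComponent (FixedPoints.addSubgroup N M ⧸ (subOne N M γ).range) p :=
    fun x ↦ ⟨w x.1, by
      obtain ⟨k, hk⟩ := x.2
      exact (AddCommGroup.mem_primaryComponent).mpr ⟨k, by rw [← map_nsmul, hk, map_zero]⟩⟩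
  have hf : Function.Injective f := fun x y hxy ↦ Subtype.ext (hw (Subtype.ext_iff.mp hxy))
  have hfsurj : Function.Surjective f := by
    rintro ⟨q, hq⟩
    obtain ⟨k, hk⟩ := (AddCommGroup.mem_primaryComponent).mp hq
    obtain ⟨m, rfl⟩ := QuotientAddGroup.mk_surjective q
    -- `p^k m = (γ - 1) y`, `y = p^k y' + c` with `c` `p`-power torsion
    rw [← QuotientAddGroup.mk_nsmul, QuotientAddGroup.eq_zero_iff] at hk
    obtain ⟨y, hy⟩ := hk
    obtain ⟨y', hy'⟩ := exists_sub_pow_smul_mem p hdiv k y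
    -- `b = m - (γ - 1) y'` is `p`-power torsion and has the same class as `m`
    set b : FixedPoints.addSubgroup N M := m - subOne N M γ y' with hb
    have hbprim : b ∈ AddCommGroup.primaryComponent (FixedPoints.addSubgroup N M) p := by
      refine mem_primaryComponent_of_nsmul_mem p (k := k) ?_
      have e : p ^ k • b = subOne N M γ (y - p ^ k • y') := by
        rw [hb, smul_sub, map_sub, map_nsmul, hy]
      rw [e]
      exact map_mem_primaryComponent p _ hy'
    obtain ⟨j, hj⟩ := (AddCommGroup.mem_primaryComponent).mp hbprim
    obtain ⟨ψ, hψN, hψγ⟩ := hinf b ⟨j, hj⟩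
    -- the class of `ψ` lies in `ker res` and is `p`-power torsion
    have hmem : oneCocycleClass _ ψ ∈ subgroupResKer M N := by
      rw [mem_subgroupResKer_iff, resSubgroup_oneCocycleClass]
      have h0 : contOneCocycles.pullback (Literature.NumberTheory.EllipticCurves.subgroupIncl N)
          (resHomOfEquivariant (Literature.NumberTheory.EllipticCurves.subgroupIncl N) (AddMonoidHom.id M) (fun _ _ ↦ rfl)) ψ = 0 := by
        apply Subtype.ext
        ext n
        rw [pullback_subtype_apply]
        exact hψN n n.2
      rw [h0, oneCocycleClass_zero]
    have hwx : w ⟨_, hmem⟩ = QuotientAddGroup.mk b := by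
      rw [hwval ⟨_, hmem⟩ ψ hψN rfl]
      exact congrArg _ (Subtype.ext hψγ)
    have htors : ∃ k : ℕ, p ^ k • (⟨_, hmem⟩ : subgroupResKer M N) = 0 := by
      refine ⟨j, hw ?_⟩
      rw [map_nsmul, map_zero, hwx, ← QuotientAddGroup.mk_nsmul, hj, QuotientAddGroup.mk_zero]
    refine ⟨⟨⟨_, hmem⟩, htors⟩, Subtype.ext ?_⟩
    change w ⟨_, hmem⟩ = QuotientAddGroup.mk m
    rw [hwx, QuotientAddGroup.eq_iff_sub_mem]
    exact ⟨-y', by rw [hb, map_neg]; abel⟩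
  exact Nat.card_congr (Equiv.ofBijective f ⟨hf, hfsurj⟩)

end Generic

/-! ## §2 The local tower at a non-split place: inflation cocycles and the exact count -/

section Local

variable {K : Type u} [Field K] (W : WeierstrassCurve K) {p : ℕ} [hp : Fact p.Prime]
  (κ : ZpExtension K p) (E : Type u) [Field E] [CharZero E] [Algebra K E]

/-- **A topological generator of `Γ_E` modulo `H_{E,∞}` with inflation cocycles for every
`p`-power-torsion value.** If `E` does not split completely in `K_∞/K`, there is `g ∈ Γ_E` which
together with `H_{E,∞} = Gal(K̄_E/K_∞·E)` generates `Γ_E` topologically, such that every point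
`b ∈ E(K̄_E)` fixed by `H_{E,∞}` and killed by a power of `p` is the value at `g` of a continuous
cocycle on `H_{E,0} = Γ_E` vanishing on `H_{E,∞}`: take the local `ℤ_p`-extension `κ_E` of file 51
(`ker κ_E = H_{E,∞}`, `κ_E g = 1`) and the tree's inflation cocycle on the `p`-primary
`Γ_E`-module `E(K̄_E)[p^∞]` (`ZpExtension.exists_cocycle_vanishing_apply_eq`), pushed into
`E(K̄_E)`. [cite: GreenbergLNM1716, §3 Lemma 3.3 (p. 87)] [cite: SerreGaloisCohomology1997, XIII.§1] -/
theorem exists_generator_and_cocycles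
    (hE : ∃ δ : Field.absoluteGaloisGroup E, resGal (K := K) E δ ∉ κ.kerSubgroup) :
    ∃ (g : Field.absoluteGaloisGroup E) (hg : g ∈ localSubgroup (κ.layerSubgroup 0) E),
      (∀ U : Subgroup (Field.absoluteGaloisGroup E),
        IsOpen (U : Set (Field.absoluteGaloisGroup E)) → localSubgroup κ.kerSubgroup E ≤ U →
          g ∈ U → localSubgroup (κ.layerSubgroup 0) E ≤ U) ∧
      ∀ b : localPoints W E, (∀ τ ∈ localSubgroup κ.kerSubgroup E, τ • b = b) →
        (∃ k : ℕ, p ^ k • b = 0) →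
        ∃ ψ : contOneCocycles (discreteTopRep (localSubgroup (κ.layerSubgroup 0) E) (localPoints W E)),
          (∀ (τ : Field.absoluteGaloisGroup E) (hτ : τ ∈ localSubgroup κ.kerSubgroup E),
            ψ.1 ⟨τ, WeierstrassCurve.localSubgroup_ker_le_layer κ E 0 hτ⟩ = 0) ∧
          ψ.1 ⟨g, hg⟩ = b := by
  obtain ⟨κE, g, hker, hγ, -⟩ := exists_localZpExtension κ E hE
  have hmem0 : ∀ σ : Field.absoluteGaloisGroup E, σ ∈ localSubgroup (κ.layerSubgroup 0) E :=
    fun σ ↦ by rw [mem_localSubgroup_iff, layerSubgroup_zero]; exact Subgroup.mem_top _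
  refine ⟨g, hmem0 g, fun U hU hNU hgU σ _ ↦ ?_, fun b hbfix hbtors ↦ ?_⟩
  · -- topological generation, from `κ_E`
    have hle : κE.layerSubgroup 0 ≤ U :=
      κE.layerSubgroup_le_of_isOpen hγ 0 U hU (by rw [hker]; exact hNU) (by rwa [pow_zero, pow_one])
    exact hle (by rw [layerSubgroup_zero]; exact Subgroup.mem_top σ)
  · -- the inflation cocycle on the `p`-primary module `T = E(K̄_E)[p^∞]`
    let T : AddSubgroup (localPoints W E) := AddCommGroup.primaryComponent (localPoints W E) p
    have hcontT : ∀ t : T, Continuous fun σ : Field.absoluteGaloisGroup E ↦ σ • t := fun t ↦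
      (continuous_smul_localPoints W E (t : localPoints W E)).subtype_mk _
    have hprimT : ∀ t : T, ∃ k : ℕ, p ^ k • t = 0 := fun t ↦ by
      obtain ⟨k, hk⟩ := (AddCommGroup.mem_primaryComponent).mp t.2
      exact ⟨k, Subtype.ext (by rw [AddSubgroupClass.coe_nsmul, hk, ZeroMemClass.coe_zero])⟩
    have hbT : b ∈ T := (AddCommGroup.mem_primaryComponent).mpr hbtors
    have hbfix' : ∀ τ ∈ κE.kerSubgroup, τ • (⟨b, hbT⟩ : T) = ⟨b, hbT⟩ := fun τ hτ ↦
      Subtype.ext (hbfix τ (by rw [← hker]; exact hτ))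
    obtain ⟨ψ, hψN, hψγ⟩ :=
      κE.exists_cocycle_vanishing_apply_eq hγ 0 hcontT hprimT ⟨b, hbT⟩ hbfix'
    -- pull back along `H_{E,0} ≤ κ_E⁻¹(p⁰ℤ_p) = ⊤`, with coefficients `T ↪ E(K̄_E)`
    have h0 : localSubgroup (κ.layerSubgroup 0) E ≤ κE.layerSubgroup 0 := fun σ _ ↦ by
      rw [layerSubgroup_zero]; exact Subgroup.mem_top σ
    refine ⟨contOneCocycles.pullback (subgroupInclusion h0)
      (resHomOfEquivariant (subgroupInclusion h0) T.subtype (fun _ _ ↦ rfl)) ψ,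
      fun τ hτ ↦ ?_, ?_⟩
    · rw [contOneCocycles.pullback_apply]
      have h := hψN τ (by rw [hker]; exact hτ)
      change (T.subtype (ψ.1 (subgroupInclusion h0 ⟨τ, _⟩)) : localPoints W E) = 0
      have e : subgroupInclusion h0 ⟨τ, WeierstrassCurve.localSubgroup_ker_le_layer κ E 0 hτ⟩ =
          ⟨τ, κE.kerSubgroup_le_layerSubgroup 0 (by rw [hker]; exact hτ)⟩ := Subtype.ext rfl
      rw [e, h]
      rfl
    · rw [contOneCocycles.pullback_apply]
      change (T.subtype (ψ.1 (subgroupInclusion h0 ⟨g, _⟩)) : localPoints W E) = b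
      have e : subgroupInclusion h0 ⟨g, hmem0 g⟩ = ⟨g ^ p ^ 0, κE.pow_mem_layerSubgroup hγ 0⟩ :=
        Subtype.ext (show g = g ^ p ^ 0 by rw [pow_zero, pow_one])
      rw [e, hψγ]
      rfl

/-- **`#𝒦_{E,0}[p^∞] = #(E(K_∞·E)/(g−1)E(K_∞·E))[p^∞]` — the EQUALITY form of the tree's
`finite_localTowerKerPrimary_and_card_le` at `n = 0`**, for the generator `g` of
`exists_generator_and_cocycles`, whenever `E(K_∞·E)` is `p`-divisible modulo its `p`-power torsion
and the right side is finite. Ingredients: `𝒦_{E,0} = ker(res : H¹(H_{E,0}, E(K̄_E)) → H¹(H_{E,∞}, ·))`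
transported to the subgroup-kernel of the tree (both directions, the second by the cocycle
description `exists_cocycle_of_res_eq_zero`), §1 applied to the inflation cocycles, and the
identification of the fixed points / `g − 1` under `N = H_{E,∞} ≃ H_{E,∞}`.
[cite: GreenbergLNM1716, §3 Lemma 3.3 (proof, p. 87)] -/
theorem natCard_localTowerKerPrimary_zero_eq
    (hE : ∃ δ : Field.absoluteGaloisGroup E, resGal (K := K) E δ ∉ κ.kerSubgroup) :
    ∃ (g : Field.absoluteGaloisGroup E),
      g ∈ localSubgroup (κ.layerSubgroup 0) E ∧
      (∀ U : Subgroup (Field.absoluteGaloisGroup E),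
        IsOpen (U : Set (Field.absoluteGaloisGroup E)) → localSubgroup κ.kerSubgroup E ≤ U →
          g ∈ U → localSubgroup (κ.layerSubgroup 0) E ≤ U) ∧
      ((∀ y : FixedPoints.addSubgroup (localSubgroup κ.kerSubgroup E) (localPoints W E),
          ∃ y' : FixedPoints.addSubgroup (localSubgroup κ.kerSubgroup E) (localPoints W E),
            y - p • y' ∈ AddCommGroup.primaryComponent
              (FixedPoints.addSubgroup (localSubgroup κ.kerSubgroup E) (localPoints W E)) p) →
        Finite (AddCommGroup.primaryComponent
          (FixedPoints.addSubgroup (localSubgroup κ.kerSubgroup E) (localPoints W E) ⧸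
            (subOne (localSubgroup κ.kerSubgroup E) (localPoints W E) g).range) p) →
        Nat.card (W.localTowerKerPrimary κ E 0) =
          Nat.card (AddCommGroup.primaryComponent
            (FixedPoints.addSubgroup (localSubgroup κ.kerSubgroup E) (localPoints W E) ⧸
              (subOne (localSubgroup κ.kerSubgroup E) (localPoints W E) g).range) p)) := by
  obtain ⟨g, hg, hgen, hinf⟩ := exists_generator_and_cocycles W κ E hE
  refine ⟨g, hg, hgen, fun hdiv hfin ↦ ?_⟩
  -- notation (as in the tree's `finite_localTowerKerPrimary_and_card_le`)
  let P : Type u := localPoints W E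
  let Hn : Subgroup (Field.absoluteGaloisGroup E) := localSubgroup (κ.layerSubgroup 0) E
  let Hi : Subgroup (Field.absoluteGaloisGroup E) := localSubgroup κ.kerSubgroup E
  let N : Subgroup Hn := Hi.subgroupOf Hn
  let γ : Hn := ⟨g, hg⟩
  have hle : Hi ≤ Hn := WeierstrassCurve.localSubgroup_ker_le_layer κ E 0
  -- (1) generation inside `H_{E,0}`
  have hgen' : ∀ U : Subgroup Hn, IsOpen (U : Set Hn) → N ≤ U → γ ∈ U → U = ⊤ := by
    intro U hU hNU hγU
    let U' : Subgroup (Field.absoluteGaloisGroup E) := U.map Hn.subtype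
    have hopen : IsOpen (U' : Set (Field.absoluteGaloisGroup E)) :=
      (isOpen_localSubgroup_layerSubgroup E κ 0).isOpenMap_subtype_val _ hU
    have hN' : Hi ≤ U' := fun τ hτ ↦
      ⟨⟨τ, hle hτ⟩, hNU (Subgroup.mem_subgroupOf.mpr hτ), rfl⟩
    have hγU' : g ∈ U' := ⟨γ, hγU, rfl⟩
    have hle' := hgen U' hopen hN' hγU'
    rw [eq_top_iff]
    intro x _
    obtain ⟨u, hu, hux⟩ := hle' x.2
    have : u = x := Subtype.ext hux
    exact this ▸ hu
  -- (2) orbit maps on `H_{E,0}`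
  have hcont : ∀ m : P, Continuous fun x : Hn ↦ x • m := fun m ↦
    (continuous_smul_localPoints W E m).comp continuous_subtype_val
  -- (3) `P^N = P^{H_{E,∞}}`, compatibly with `g − 1`, `p`-divisibility and `p`-power torsion
  have hfix : FixedPoints.addSubgroup N P = FixedPoints.addSubgroup Hi P := by
    ext m
    simp only [FixedPoints.mem_addSubgroup]
    constructor
    · intro h τ
      exact h ⟨⟨τ, hle τ.2⟩, Subgroup.mem_subgroupOf.mpr τ.2⟩
    · intro h x
      exact h ⟨((x : Hn) : Field.absoluteGaloisGroup E), Subgroup.mem_subgroupOf.mp x.2⟩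
  let e : FixedPoints.addSubgroup N P ≃+ FixedPoints.addSubgroup Hi P :=
    AddEquiv.addSubgroupCongr hfix
  have he_coe : ∀ y : FixedPoints.addSubgroup N P, ((e y : FixedPoints.addSubgroup Hi P) : P) = y :=
    fun _ ↦ rfl
  have he : AddSubgroup.map (e : FixedPoints.addSubgroup N P →+ FixedPoints.addSubgroup Hi P)
      (subOne N P γ).range = (subOne Hi P g).range := by
    ext b
    constructor
    · rintro ⟨x, ⟨y, rfl⟩, rfl⟩
      exact ⟨e y, Subtype.ext rfl⟩
    · rintro ⟨y, rfl⟩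
      exact ⟨subOne N P γ (e.symm y), ⟨e.symm y, rfl⟩, Subtype.ext rfl⟩
  let eq : FixedPoints.addSubgroup N P ⧸ (subOne N P γ).range ≃+
      FixedPoints.addSubgroup Hi P ⧸ (subOne Hi P g).range :=
    QuotientAddGroup.congr _ _ e he
  let ep : AddCommGroup.primaryComponent (FixedPoints.addSubgroup N P ⧸ (subOne N P γ).range) p ≃
      AddCommGroup.primaryComponent (FixedPoints.addSubgroup Hi P ⧸ (subOne Hi P g).range) p :=
    eq.toEquiv.subtypeEquiv fun a ↦ by
      simp only [AddCommGroup.mem_primaryComponent, AddEquiv.toEquiv_eq_coe, EquivLike.coe_coe]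
      constructor
      · rintro ⟨k, hk⟩
        exact ⟨k, by rw [← map_nsmul, hk, map_zero]⟩
      · rintro ⟨k, hk⟩
        refine ⟨k, eq.injective ?_⟩
        rw [map_nsmul, hk, map_zero]
  haveI : Finite (AddCommGroup.primaryComponent
      (FixedPoints.addSubgroup N P ⧸ (subOne N P γ).range) p) := Finite.of_equiv _ ep.symm
  have hcardp : Nat.card (AddCommGroup.primaryComponent
      (FixedPoints.addSubgroup N P ⧸ (subOne N P γ).range) p) =
      Nat.card (AddCommGroup.primaryComponent
        (FixedPoints.addSubgroup Hi P ⧸ (subOne Hi P g).range) p) :=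
    Nat.card_congr ep
  -- (hinf) and (hdiv) transported to `N`
  have hinfN : ∀ b : FixedPoints.addSubgroup N P, (∃ k : ℕ, p ^ k • b = 0) →
      ∃ ψ : contOneCocycles (discreteTopRep Hn P), (∀ n ∈ N, ψ.1 n = 0) ∧ ψ.1 γ = b := by
    rintro b ⟨k, hk⟩
    have hbfix : ∀ τ ∈ Hi, τ • (b : P) = b := fun τ hτ ↦ (e b).2 ⟨τ, hτ⟩
    have hbk : p ^ k • (b : P) = 0 := by
      have := congrArg (fun z : FixedPoints.addSubgroup N P ↦ (z : P)) hk
      simpa only [AddSubgroupClass.coe_nsmul, ZeroMemClass.coe_zero] using this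
    obtain ⟨ψ, hψN, hψg⟩ := hinf (b : P) hbfix ⟨k, hbk⟩
    refine ⟨ψ, fun n hn ↦ ?_, hψg⟩
    have h := hψN ((n : Hn) : Field.absoluteGaloisGroup E) (Subgroup.mem_subgroupOf.mp hn)
    have en : (⟨((n : Hn) : Field.absoluteGaloisGroup E),
        WeierstrassCurve.localSubgroup_ker_le_layer κ E 0 (Subgroup.mem_subgroupOf.mp hn)⟩ : Hn) = n :=
      Subtype.ext rfl
    rwa [en] at h
  have hdivN : ∀ y : FixedPoints.addSubgroup N P, ∃ y' : FixedPoints.addSubgroup N P,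
      y - p • y' ∈ AddCommGroup.primaryComponent (FixedPoints.addSubgroup N P) p := by
    intro y
    obtain ⟨y', hy'⟩ := hdiv (e y)
    refine ⟨e.symm y', ?_⟩
    obtain ⟨k, hk⟩ := (AddCommGroup.mem_primaryComponent).mp hy'
    refine (AddCommGroup.mem_primaryComponent).mpr ⟨k, e.injective ?_⟩
    rw [map_nsmul, map_sub, map_nsmul, AddEquiv.apply_symm_apply, hk, map_zero]
  -- (4) the generic count on `H_{E,0}`
  have hcount := natCard_primary_subgroupResKer_eq N P γ hgen' hcont p hinfN hdivN
  -- (5) `𝒦_{E,0} = ker (res : H¹(H_{E,0}, P) → H¹(N, P))`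
  let j : N →ₜ* Hi :=
    { toFun := fun x ↦ ⟨((x : Hn) : Field.absoluteGaloisGroup E), Subgroup.mem_subgroupOf.mp x.2⟩
      map_one' := rfl
      map_mul' := fun _ _ ↦ rfl
      continuous_toFun :=
        (continuous_subtype_val.comp continuous_subtype_val).subtype_mk _ }
  have hcomp : (resH1Hom j (AddMonoidHom.id P) (fun _ _ ↦ rfl)).comp
      (Literature.NumberTheory.EllipticCurves.resOfLe P hle) = resSubgroup N P := by
    unfold Literature.NumberTheory.EllipticCurves.resOfLe ResKernel.resSubgroup
    rw [resH1Hom_comp]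
    exact resH1Hom_congr (ContinuousMonoidHom.ext fun _ ↦ rfl) (AddMonoidHom.ext fun _ ↦ rfl) _ _
  have hker : W.localTowerKer κ E 0 = subgroupResKer P N := by
    apply le_antisymm
    · intro c hc
      rw [mem_subgroupResKer_iff, ← hcomp, AddMonoidHom.comp_apply,
        (W.mem_localTowerKer_iff κ E 0 c).mp hc, map_zero]
    · intro c hc
      -- a class dying on `N` is represented by a cocycle vanishing on `N`, i.e. on `H_{E,∞}`
      obtain ⟨φ, rfl, hφN⟩ := exists_cocycle_of_res_eq_zero N P hcont c hc
      rw [W.mem_localTowerKer_iff κ E 0]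
      change Literature.NumberTheory.EllipticCurves.resOfLe P hle (oneCocycleClass _ φ) = 0
      have h0 : oneCocycleClass _ (contOneCocycles.pullback (subgroupInclusion hle)
          (resHomOfEquivariant (subgroupInclusion hle) (AddMonoidHom.id P) (fun _ _ ↦ rfl)) φ) = 0 := by
        rw [oneCocycleClass_eq_zero_iff]
        refine ⟨0, fun τ ↦ ?_⟩
        rw [map_zero, sub_zero, contOneCocycles.pullback_apply]
        exact hφN ⟨(τ : Field.absoluteGaloisGroup E), hle τ.2⟩ (Subgroup.mem_subgroupOf.mpr τ.2)
      rw [← map_oneCocycleClass] at h0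
      exact h0
  -- (6) `𝒦_{E,0}[p^∞] ≃ {x ∈ ker res | p-power torsion}`
  let f : W.localTowerKerPrimary κ E 0 ≃ {x : subgroupResKer P N // ∃ k : ℕ, p ^ k • x = 0} :=
    { toFun := fun c ↦ ⟨⟨(c : discreteH1 Hn P), hker.le ((W.mem_localTowerKerPrimary_iff κ E 0 _).mp c.2).1⟩, by
        obtain ⟨k, hk⟩ := ((W.mem_localTowerKerPrimary_iff κ E 0 _).mp c.2).2
        exact ⟨k, Subtype.ext hk⟩⟩
      invFun := fun x ↦ ⟨((x.1 : subgroupResKer P N) : discreteH1 Hn P),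
        (W.mem_localTowerKerPrimary_iff κ E 0 _).mpr ⟨hker.symm.le x.1.2, by
          obtain ⟨k, hk⟩ := x.2
          exact ⟨k, by
            have := congrArg (fun z : subgroupResKer P N ↦ (z : discreteH1 Hn P)) hk
            simpa only [AddSubgroupClass.coe_nsmul, ZeroMemClass.coe_zero] using this⟩⟩⟩
      left_inv := fun c ↦ Subtype.ext rfl
      right_inv := fun x ↦ Subtype.ext (Subtype.ext rfl) }
  rw [Nat.card_congr f, hcount, hcardp]

end Local

end Summit.BirchSwinnertonDyer.Rank1Residual.Additive

end
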